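import Summits.KontsevichZagierPeriods.KontsevichZagierPeriods.Theorems.VietaFibreKernelFormItemDictionary
import Summits.KontsevichZagierPeriods.KontsevichZagierPeriods.Theorems.VietaFibreKernelFormRingDictionary
import Summits.KontsevichZagierPeriods.KontsevichZagierPeriods.Theorems.VietaFibreKernelFormIsSummit
import Summits.KontsevichZagierPeriods.KontsevichZagierPeriods.Theorems.LiouvilleUnfoldingAyoubPiLocalKernelStubLocallyReducedOnTorsion
import HarnessLib

/-!
# Crux `KernelForm` (stmt-KontsevichZagierPeriods-10447) — skeleton for the PIECE `stub_positiveCancellation`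
# (= item stmt-KontsevichZagierPeriods-5621 `SelbergAMGM.PositiveCancellation`, the bare side of the bridge split
# `KernelForm ⇐ AyoubPiLocalKernel (0541) ∧ PositiveCancellation (5621)`)

Route VietaFibre's deciding crux `KernelForm` is the summit restated (`kernelForm_iff_summit`, p125241) and is
redirected one level down by `kernelForm_iff_ayoubPiLocalKernel_and_positiveCancellation` (p121847).  The
`0541` side has a registered line (`Cruxes/AyoubPiLocalKernel/Lines/SketchIdeator2.lean`, the nil-cut
`(N) ∧ (R)`); this file is the plan for the OTHER side, `PositiveCancellation` (≡ `Cancellation`: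
every class of non-zero value is a non-zero-divisor of the formal period ring `P = FormalRep ⧸ relations`,
`cancellation_iff_positiveCancellation`, p115347).

## The cut: the three classical sources of a zero-divisor, one stub each

Write `P := KZ.FormalPeriodRing`, `ϖ := KZ.toFormalPeriod (KZ.of KZ.piRep)` (the class of the disc `[π]`,
`evalP ϖ = π ≠ 0`) and `𝔭 := ker evalP` (the Lebesgue point of `Spec P`).  A zero-divisor relation
`s * x = 0` with `evalP s ≠ 0` can only come from (i) `ϖ`-power torsion, (ii) nilpotents, (iii) an irreducible
component of `Spec P[ϖ⁻¹]` missing the point `𝔭`.  Accordingly: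

* `stub_ayoubPiCancellation` — **(i) `ϖ` is a non-zero-divisor** = item stmt-0540 BY NAME (route VietaFibre's own
  child decl, byte-identical with `AyoubSpecialisation.AyoubPiCancellation ↔ KZ.PiCancellation`,
  `BetaCancellationLine.stub_ayoubBridge`); live line `Cruxes/AyoubPiCancellation/Lines/Sketch.lean`.
* `stub_locallyReducedOnTorsion` — **(ii) `P[ϖ⁻¹]` is reduced on the `ϖ`-locally nil classes**, VERBATIM the
  registered stub (R) of item 0541's line `SketchIdeator2` (so the two sides of the bridge split SHARE this stub);
  implied by item stmt-3929 `ReducedPeriodRing` (`locallyReducedOnTorsion_of_reducedPeriodRing`, p138593) and by the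
  summit; `↔ IsReduced (Localization.Away ϖ)` (`locallyReducedOnTorsion_iff_isReduced_away`).
* `stub_zeroDivisorsLocallyNil` — **(iii) every zero-divisor killed by a class of non-zero value is `ϖ`-locally
  NILPOTENT** (`∃ N k, ϖ ^ N * x ^ (k+1) = 0`), i.e. lies in every prime `q ∌ ϖ`; geometrically: every irreducible
  component of `Spec P[ϖ⁻¹]` passes through the Lebesgue point.  NEW, the weakest statement of the lattice: it is
  implied by the piece itself (`x = 0`), by the transcendence stub (N) of 0541's line (zero-divisors have value `0`),
  hence by either side of the bridge split; its motivic shadow is the connectedness/irreducibility of the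
  localised period torsor (Kontsevich–Zagier 2001 §4.1 `P̂ = P[(2πi)⁻¹]`; Ayoub 2014 Conj. 7 asks `𝔭 = 0` there).

Composition (`cancellation_of_stubs`, sorry-free): `s * x = 0`, `evalP s ≠ 0` ⟹ (iii) `ϖ^N x^(k+1) = 0`
⟹ (ii) `ϖ^M x = 0` ⟹ (i), `M` times, `x = 0`; then `cancellation_iff_positiveCancellation`.
`PositiveCancellation_of` concludes `Theses.SelbergAMGM.PositiveCancellation` BY NAME from the three stubs.

Exactness bookkeeping (all proved below): the EXACT two-piece form of the cut is
`PositiveCancellation ↔ AyoubPiCancellation ∧ LocalisedCancellation` with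
`LocalisedCancellation := ∀ x s, evalP s ≠ 0 → s * x = 0 → ∃ N, ϖ ^ N * x = 0` ("cancellation holds in `P[ϖ⁻¹]`"),
and `LocalisedCancellation ⇐ (R) ∧ (iii)`.  Stubs (i) and (iii) are consequences of the piece; (R) is a
consequence of the summit and of item 3929 but not of the piece alone (abstract model `ℝ[ε]/(ε²)`, `ϖ ↦ π`:
cancellation holds, (R) fails) — a refutation of (R) would refute item 3929 and Conjecture 1, not only this line.
No stub implies the piece or the summit on its own (abstract models: `ℝ × ℝ` with `ϖ ↦ (π, π)` has (i), (ii) and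
not (iii); `ℝ[s, ε]/(ε², sε)` has (iii) and neither cancellation nor (ii); per-stub probes in the seat folder `bc/`).

References: M. Kontsevich, D. Zagier, *Periods* (2001), §1.2 Conjecture 1, §4.1; J. Ayoub, *Periods and the
conjectures of Grothendieck and Kontsevich–Zagier*, EMS Newsl. 91 (2014), Def. 6, Conj. 7; A. Huber,
G. Wüstholz, *Transcendence and linear relations of 1-periods* (2022), App. A.3–A.4 (the motivic shadow of (i) is
open in print); A. Huber, S. Müller-Stach, *Periods and Nori motives* (2017), Ch. 13.
-/

noncomputable section

set_option linter.dupNamespace false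

open Literature.NumberTheory.Transcendental

namespace Summit.KontsevichZagierPeriods.KontsevichZagierPeriods.Cruxes.KernelForm.PositiveCancellationPiece

open Summit.KontsevichZagierPeriods.KernelForm.LocaliseAtValuePrime
open Summit.KontsevichZagierPeriods.KontsevichZagierPeriods.Theses.SelbergAMGM (PositiveCancellation)

/-! ## The three registered stubs -/

/-- **Stub (i) = item stmt-KontsevichZagierPeriods-0540 verbatim** (route VietaFibre's own child
`AyoubPiCancellation`; `↔ KZ.PiCancellation`: the disc class `ϖ = ⟦[π]⟧` is a non-zero-divisor of
`P = FormalRep ⧸ relations`).  Conjecture-grade but transcendence-free; motivic shadow (injectivity of effective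
into `2πi`-localised formal periods) open in print (Huber–Wüstholz 2022, App. A.4).  Not worker-sized: it closes
when item 0540 closes (live line `Cruxes/AyoubPiCancellation/Lines/Sketch.lean`). -/
theorem stub_ayoubPiCancellation :
    Summit.KontsevichZagierPeriods.KontsevichZagierPeriods.Theses.VietaFibre.AyoubPiCancellation := by
  sorry

/-- **Stub (ii) — `LocallyReducedOnTorsion` (R)**, verbatim the registered stub of item 0541's line
`SketchIdeator2` (shared between the two sides of the bridge split): a `ϖ`-locally nilpotent class is `ϖ`-power
torsion, i.e. `P[ϖ⁻¹]` is reduced (`locallyReducedOnTorsion_iff_isReduced_away`).  Implied by item stmt-3929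
`ReducedPeriodRing` (`locallyReducedOnTorsion_of_reducedPeriodRing`) and by the summit; transcendence-free;
motivic shadow = Cartier reducedness of the localised period torsor. -/
theorem stub_locallyReducedOnTorsion :
    ∀ x : KZ.FormalPeriodRing,
      (∃ N k : ℕ, KZ.toFormalPeriod (KZ.of KZ.piRep) ^ N * x ^ (k + 1) = 0) →
        ∃ N : ℕ, KZ.toFormalPeriod (KZ.of KZ.piRep) ^ N * x = 0 := by
  sorry

/-- **Stub (iii) — `ZeroDivisorsLocallyNil`** (new): a class killed by a class of NON-ZERO VALUE is
`ϖ`-locally nilpotent — it lies in every prime ideal of `P` not containing the disc class; every irreducible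
component of `Spec P[ϖ⁻¹]` passes through the Lebesgue point `ker evalP`.  The weakest statement of the
lattice: implied by the piece (`x = 0`, `N = k = 0`) and by the transcendence stub (N) of 0541's line (a
zero-divisor has value `0` by soundness).  Conjecture-grade, transcendence-free. -/
theorem stub_zeroDivisorsLocallyNil :
    ∀ x s : KZ.FormalPeriodRing, KZ.evalP s ≠ 0 → s * x = 0 →
      ∃ N k : ℕ, KZ.toFormalPeriod (KZ.of KZ.piRep) ^ N * x ^ (k + 1) = 0 := by
  sorry

/-! ## Bookkeeping in the formal period ring -/

/-- `KZ.PiCancellation` in `P`: the disc class kills no non-zero class. [folklore] -/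
theorem eq_zero_of_piClass_mul_eq_zero (hP : KZ.PiCancellation) {x : KZ.FormalPeriodRing}
    (hx : KZ.toFormalPeriod (KZ.of KZ.piRep) * x = 0) : x = 0 := by
  obtain ⟨c, rfl⟩ := KZ.toFormalPeriod_surjective x
  rw [← map_mul, KZ.toFormalPeriod_eq_zero_iff] at hx
  exact KZ.toFormalPeriod_eq_zero_iff.mpr (hP c hx)

/-- Peeling powers of the disc class under `KZ.PiCancellation`: `ϖ ^ N * x = 0 → x = 0`. [folklore] -/
theorem eq_zero_of_piClass_pow_mul_eq_zero (hP : KZ.PiCancellation) :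
    ∀ (N : ℕ) {x : KZ.FormalPeriodRing}, KZ.toFormalPeriod (KZ.of KZ.piRep) ^ N * x = 0 → x = 0 := by
  intro N
  induction N with
  | zero => intro x hx; simpa using hx
  | succ N ih =>
    intro x hx
    apply ih
    apply eq_zero_of_piClass_mul_eq_zero hP
    rw [← mul_assoc, ← pow_succ', hx]

/-- Route VietaFibre's child decl of item 0540 is `KZ.PiCancellation` (same term as
`AyoubSpecialisation.AyoubPiCancellation`, then `BetaCancellationLine.stub_ayoubBridge`). [folklore] -/
theorem piCancellation_of_vietaFibre
    (h : Summit.KontsevichZagierPeriods.KontsevichZagierPeriods.Theses.VietaFibre.AyoubPiCancellation) :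
    KZ.PiCancellation :=
  Summit.KontsevichZagierPeriods.KontsevichZagierPeriods.BetaCancellationLine.stub_ayoubBridge.mp h

/-! ## Composition: the piece from the stubs -/

/-- **`Cancellation` from the three stubs** (hypothesis form): `s * x = 0` with `evalP s ≠ 0` ⟹ (iii)
`ϖ ^ N * x ^ (k+1) = 0` ⟹ (ii) `ϖ ^ M * x = 0` ⟹ (i) `x = 0`. [folklore] -/
theorem cancellation_of_stubs
    (h₁ : Summit.KontsevichZagierPeriods.KontsevichZagierPeriods.Theses.VietaFibre.AyoubPiCancellation)
    (h₂ : ∀ x : KZ.FormalPeriodRing,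
      (∃ N k : ℕ, KZ.toFormalPeriod (KZ.of KZ.piRep) ^ N * x ^ (k + 1) = 0) →
        ∃ N : ℕ, KZ.toFormalPeriod (KZ.of KZ.piRep) ^ N * x = 0)
    (h₃ : ∀ x s : KZ.FormalPeriodRing, KZ.evalP s ≠ 0 → s * x = 0 →
      ∃ N k : ℕ, KZ.toFormalPeriod (KZ.of KZ.piRep) ^ N * x ^ (k + 1) = 0) :
    ∀ c s : KZ.FormalRep, KZ.eval s ≠ 0 → s * c ∈ KZ.relations → c ∈ KZ.relations := by
  intro c s hs hsc
  have hs' : KZ.evalP (KZ.toFormalPeriod s) ≠ 0 := by rwa [KZ.evalP_toFormalPeriod]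
  have hsc' : KZ.toFormalPeriod s * KZ.toFormalPeriod c = 0 :=
    (toFormalPeriod_mul_toFormalPeriod_eq_zero_iff s c).mpr hsc
  obtain ⟨M, hM⟩ := h₂ _ (h₃ _ _ hs' hsc')
  exact KZ.toFormalPeriod_eq_zero_iff.mp
    (eq_zero_of_piClass_pow_mul_eq_zero (piCancellation_of_vietaFibre h₁) M hM)

/-- **The line's deciding step**: the three registered stubs prove the piece
`Theses.SelbergAMGM.PositiveCancellation` (item stmt-KontsevichZagierPeriods-5621, the former skeleton stub
`stub_positiveCancellation` of crux 10447) BY NAME. [folklore] -/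
theorem PositiveCancellation_of : PositiveCancellation :=
  cancellation_iff_positiveCancellation.mp
    (cancellation_of_stubs stub_ayoubPiCancellation stub_locallyReducedOnTorsion stub_zeroDivisorsLocallyNil)

/- **The piece from the stubs** in the literal BC3 shape `stub₁-sig → stub₂-sig → stub₃-sig → C` — an `example`, not a
declaration: the skeleton audit takes a NAMED theorem concluding the crux as the line's composition and requires its
hypotheses to be registered obligations by name, so the named composition is `PositiveCancellation_of` above and the
hypothesis form is `cancellation_of_stubs` + `cancellation_iff_positiveCancellation`. -/
example :
    Summit.KontsevichZagierPeriods.KontsevichZagierPeriods.Theses.VietaFibre.AyoubPiCancellation →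
    (∀ x : KZ.FormalPeriodRing,
      (∃ N k : ℕ, KZ.toFormalPeriod (KZ.of KZ.piRep) ^ N * x ^ (k + 1) = 0) →
        ∃ N : ℕ, KZ.toFormalPeriod (KZ.of KZ.piRep) ^ N * x = 0) →
    (∀ x s : KZ.FormalPeriodRing, KZ.evalP s ≠ 0 → s * x = 0 →
      ∃ N k : ℕ, KZ.toFormalPeriod (KZ.of KZ.piRep) ^ N * x ^ (k + 1) = 0) →
    PositiveCancellation :=
  fun h₁ h₂ h₃ => cancellation_iff_positiveCancellation.mp (cancellation_of_stubs h₁ h₂ h₃)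

/-- With the other side of the bridge split (item 0541, route VietaFibre's child decl) the piece closes the crux
`KernelForm` of item 10447 — recorded to show where this skeleton plugs in (`.mpr` of p121847). [folklore] -/
theorem KernelForm_of_ayoubPiLocalKernel
    (h : Summit.KontsevichZagierPeriods.KontsevichZagierPeriods.Theses.VietaFibre.AyoubPiLocalKernel) :
    Summit.KontsevichZagierPeriods.KontsevichZagierPeriods.Theses.VietaFibre.KernelForm :=
  kernelForm_iff_ayoubPiLocalKernel_and_positiveCancellation.mpr ⟨h, PositiveCancellation_of⟩

/-! ## Position of the stubs (exactness bookkeeping, all sorry-free) -/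

/-- Stub (i) is a consequence of the piece (stmt-5621 ⇒ stmt-0540). [folklore] -/
theorem stub₁_of_piece (h : PositiveCancellation) :
    Summit.KontsevichZagierPeriods.KontsevichZagierPeriods.Theses.VietaFibre.AyoubPiCancellation :=
  ayoubPiCancellation_of_positiveCancellation h

/-- Stub (iii) is a consequence of the piece (a cancelled zero-divisor is `0`; `N = k = 0`). [folklore] -/
theorem stub₃_of_piece (h : PositiveCancellation) :
    ∀ x s : KZ.FormalPeriodRing, KZ.evalP s ≠ 0 → s * x = 0 →
      ∃ N k : ℕ, KZ.toFormalPeriod (KZ.of KZ.piRep) ^ N * x ^ (k + 1) = 0 := by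
  intro x s hs hsx
  obtain ⟨c, rfl⟩ := KZ.toFormalPeriod_surjective x
  obtain ⟨t, rfl⟩ := KZ.toFormalPeriod_surjective s
  rw [KZ.evalP_toFormalPeriod] at hs
  have hc : c ∈ KZ.relations :=
    cancellation_iff_positiveCancellation.mpr h c t hs
      ((toFormalPeriod_mul_toFormalPeriod_eq_zero_iff t c).mp hsx)
  exact ⟨0, 0, by rw [KZ.toFormalPeriod_eq_zero_iff.mpr hc]; simp⟩

/-- Stub (ii) is a consequence of item stmt-3929 `ReducedPeriodRing` (route FurushoPentagon). [folklore] -/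
theorem stub₂_of_reducedPeriodRing
    (h : Summit.KontsevichZagierPeriods.KontsevichZagierPeriods.Theses.FurushoPentagon.ReducedPeriodRing) :
    ∀ x : KZ.FormalPeriodRing,
      (∃ N k : ℕ, KZ.toFormalPeriod (KZ.of KZ.piRep) ^ N * x ^ (k + 1) = 0) →
        ∃ N : ℕ, KZ.toFormalPeriod (KZ.of KZ.piRep) ^ N * x = 0 :=
  Summit.KontsevichZagierPeriods.LiouvilleUnfolding.NilradicalCut.locallyReducedOnTorsion_of_reducedPeriodRing h

/-- Stub (iii) is a consequence of the transcendence stub (N) of item 0541's line (a zero-divisor killed by a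
class of non-zero value has value `0`, `evalP` being a ring map to the domain `ℝ`). [folklore] -/
theorem stub₃_of_nilLocalKernel
    (hN : ∀ x : KZ.FormalPeriodRing, KZ.evalP x = 0 →
      ∃ N k : ℕ, KZ.toFormalPeriod (KZ.of KZ.piRep) ^ N * x ^ (k + 1) = 0) :
    ∀ x s : KZ.FormalPeriodRing, KZ.evalP s ≠ 0 → s * x = 0 →
      ∃ N k : ℕ, KZ.toFormalPeriod (KZ.of KZ.piRep) ^ N * x ^ (k + 1) = 0 := by
  intro x s hs hsx
  apply hN
  have h0 : KZ.evalP s * KZ.evalP x = 0 := by rw [← map_mul, hsx, map_zero]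
  exact (mul_eq_zero.mp h0).resolve_left hs

/-- **All three stubs follow from the summit** (so none is refutable short of refuting Conjecture 1).
[cite: KontsevichZagier2001, §1.2 Conjecture 1] -/
theorem stubs_of_summit (h : _root_.KontsevichZagierPeriods) :
    Summit.KontsevichZagierPeriods.KontsevichZagierPeriods.Theses.VietaFibre.AyoubPiCancellation ∧
      (∀ x : KZ.FormalPeriodRing,
        (∃ N k : ℕ, KZ.toFormalPeriod (KZ.of KZ.piRep) ^ N * x ^ (k + 1) = 0) →
          ∃ N : ℕ, KZ.toFormalPeriod (KZ.of KZ.piRep) ^ N * x = 0) ∧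
      (∀ x s : KZ.FormalPeriodRing, KZ.evalP s ≠ 0 → s * x = 0 →
        ∃ N k : ℕ, KZ.toFormalPeriod (KZ.of KZ.piRep) ^ N * x ^ (k + 1) = 0) := by
  have hK : Summit.KontsevichZagierPeriods.KontsevichZagierPeriods.Theses.VietaFibre.KernelForm :=
    kernelForm_iff_summit.mpr h
  have hP : PositiveCancellation := (kernelForm_iff_ayoubPiLocalKernel_and_positiveCancellation.mp hK).2
  exact ⟨stub₁_of_piece hP,
    (Summit.KontsevichZagierPeriods.LiouvilleUnfolding.NilradicalCut.nil_and_locallyReduced_of_summit h).2,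
    stub₃_of_piece hP⟩

/-- **The EXACT two-piece form of the cut**: `PositiveCancellation ↔ AyoubPiCancellation ∧ LocalisedCancellation`,
`LocalisedCancellation := ∀ x s, evalP s ≠ 0 → s * x = 0 → ∃ N, ϖ ^ N * x = 0` (classes of non-zero value are
non-zero-divisors of `P[ϖ⁻¹]`) — the `[π]`-split of Kontsevich–Zagier 2001 §4.1 one level below `KernelForm`.
[folklore] -/
theorem positiveCancellation_iff_ayoubPiCancellation_and_localisedCancellation :
    PositiveCancellation ↔
      Summit.KontsevichZagierPeriods.KontsevichZagierPeriods.Theses.VietaFibre.AyoubPiCancellation ∧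
        ∀ x s : KZ.FormalPeriodRing, KZ.evalP s ≠ 0 → s * x = 0 →
          ∃ N : ℕ, KZ.toFormalPeriod (KZ.of KZ.piRep) ^ N * x = 0 := by
  constructor
  · intro h
    refine ⟨stub₁_of_piece h, fun x s hs hsx => ?_⟩
    obtain ⟨N, k, hNk⟩ := stub₃_of_piece h x s hs hsx
    -- under the piece the zero-divisor is `0` outright
    obtain ⟨c, rfl⟩ := KZ.toFormalPeriod_surjective x
    obtain ⟨t, rfl⟩ := KZ.toFormalPeriod_surjective s
    rw [KZ.evalP_toFormalPeriod] at hs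
    have hc : c ∈ KZ.relations :=
      cancellation_iff_positiveCancellation.mpr h c t hs
        ((toFormalPeriod_mul_toFormalPeriod_eq_zero_iff t c).mp hsx)
    exact ⟨0, by rw [KZ.toFormalPeriod_eq_zero_iff.mpr hc, mul_zero]⟩
  · rintro ⟨h₁, hL⟩
    refine cancellation_iff_positiveCancellation.mp fun c s hs hsc => ?_
    have hs' : KZ.evalP (KZ.toFormalPeriod s) ≠ 0 := by rwa [KZ.evalP_toFormalPeriod]
    obtain ⟨N, hN⟩ := hL _ _ hs' ((toFormalPeriod_mul_toFormalPeriod_eq_zero_iff s c).mpr hsc)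
    exact KZ.toFormalPeriod_eq_zero_iff.mp
      (eq_zero_of_piClass_pow_mul_eq_zero (piCancellation_of_vietaFibre h₁) N hN)

/-- `LocalisedCancellation ⇐ (R) ∧ (iii)` — how stubs (ii) and (iii) refine the exact residue. [folklore] -/
theorem localisedCancellation_of_stubs
    (h₂ : ∀ x : KZ.FormalPeriodRing,
      (∃ N k : ℕ, KZ.toFormalPeriod (KZ.of KZ.piRep) ^ N * x ^ (k + 1) = 0) →
        ∃ N : ℕ, KZ.toFormalPeriod (KZ.of KZ.piRep) ^ N * x = 0)
    (h₃ : ∀ x s : KZ.FormalPeriodRing, KZ.evalP s ≠ 0 → s * x = 0 →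
      ∃ N k : ℕ, KZ.toFormalPeriod (KZ.of KZ.piRep) ^ N * x ^ (k + 1) = 0) :
    ∀ x s : KZ.FormalPeriodRing, KZ.evalP s ≠ 0 → s * x = 0 →
      ∃ N : ℕ, KZ.toFormalPeriod (KZ.of KZ.piRep) ^ N * x = 0 :=
  fun x s hs hsx => h₂ x (h₃ x s hs hsx)

/-- `LocalisedCancellation` is also a consequence of item 0541 (route VietaFibre's child decl): the residue of
this side is implied by the OTHER side of the bridge split, so jointly the two sides need
`0541 ∧ 0540` only (= the strategist's `[π]`-split, `Split.KernelForm_of_subs`). [folklore] -/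
theorem localisedCancellation_of_ayoubPiLocalKernel
    (h : Summit.KontsevichZagierPeriods.KontsevichZagierPeriods.Theses.VietaFibre.AyoubPiLocalKernel) :
    ∀ x s : KZ.FormalPeriodRing, KZ.evalP s ≠ 0 → s * x = 0 →
      ∃ N : ℕ, KZ.toFormalPeriod (KZ.of KZ.piRep) ^ N * x = 0 := by
  have hL : KZ.PiLocalKernel := ayoubPiLocalKernel_iff_piLocalKernel.mp h
  rw [Summit.KontsevichZagierPeriods.LiouvilleUnfolding.PiLocalKernelPosition.piLocalKernel_iff_forall_evalP]
    at hL
  intro x s hs hsx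
  apply hL
  have h0 : KZ.evalP s * KZ.evalP x = 0 := by rw [← map_mul, hsx, map_zero]
  exact (mul_eq_zero.mp h0).resolve_left hs

end Summit.KontsevichZagierPeriods.KontsevichZagierPeriods.Cruxes.KernelForm.PositiveCancellationPiece

end
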